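import Summits.BirchSwinnertonDyer.BirchSwinnertonDyer.Theorems.KolyvaginDepthDoorDepthTableRankTwo707a1TwistBSDQuotient
import Summits.BirchSwinnertonDyer.BirchSwinnertonDyer.Theorems.KolyvaginDepthDoorDepthTableRankTwo997b1TwistBSDQuotient
import Summits.BirchSwinnertonDyer.BirchSwinnertonDyer.Theorems.KolyvaginDepthDoorDepthTableIntrinsic
import HarnessLib

/-!
# Route `KolyvaginDepthDoor`, crux `KolyvaginDepthSupplyKN` (stmt-BirchSwinnertonDyer-22820) —
# DEPTH TABLE v16: W. Zhang's ♠ cell (part 4: the v15 stragglers `707a1`, `997b1`) — the rows `707a1`, `997b1` INTRINSIC, UNIFORM IN THE HEEGNER FIELD `K` AND IN THE PRIME `p`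

Helper file of the lead prover of line `levelone` (kdd-p1 g20; `--supports stmt-BirchSwinnertonDyer-22820
--as helper`); it closes nothing and BSD is NOT proved by it.

v13–v15 read each rank-two row at its Heegner field OF RECORD through a kernel-certified minimal model of the twist; v15's `…Uniform`
files made 13 of them uniform in `p`. v16 (`cruxBody_of_twistBSDQuotient_intrinsic_spade`, W. Zhang's ♠ supply) removes the field of record and every
hypothesis on the twist model: for each curve below, for EVERY admissible `5 ≤ p < 1000` (good ordinary, `ρ_{E,p^n}` onto — hypotheses,
kernel-certified in the tree at the prime of record; Kodaira–Néron / ♠ uniform in `p`), EVERY imaginary quadratic `K` (`d_K ∉ {−3,−4}`, `p ∤ d_K`, Heegner — ANY parity of `d_K`) and ANY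
globally minimal model `T` of `E^{(d_K)}`:

  «`ord_{s=1} L(E^{(d_K)}, s) = 1` ∧ `ord_p(L'(T,1)/(Ω_T·Reg_T)) ≤ 1`»  ⟹  the clause of `KolyvaginDepthSupplyKN` at the curve VERBATIM.

So the crux holds at the curve as soon as ANY Heegner twist at ANY admissible prime carries the rank-one BSD-quotient datum (tolerance
`ord_p ≤ 1`); the numerical evidence at the fields of record is the observatory's CERT-TABLE (cert-2; context only).

CONDITIONAL on Stein–Wuthrich 2013 Thm. 1.1, W. Zhang 2014 L8.4 (1) / 9.1, Burungale–Castella–Skinner 2025 Cor. 1.3.1, GZK, BY NAME; per curve;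
nothing class-wide (the open stub (S♭) is untouched); BSD is NOT proved by any of this.

References: [SteinWuthrich2013] Thm. 1.1; [WZhang2014] L8.4 (1), Thm. 9.1, Hypothesis ♠; [CastellaSano2026] Thm. 3;
[BurungaleCastellaSkinner2025] Cor. 1.3.1; [Darmon2004] Thm. 3.22; [SilvermanAEC2009] VII.5.1, VIII.8, X.4.2; [CremonaAlgorithms1997] Table 1.
-/

set_option linter.dupNamespace false

noncomputable section

open scoped Classical NumberField

namespace Summit.BirchSwinnertonDyer.BirchSwinnertonDyer.Theorems.KolyvaginDepthDoor

open Literature.NumberTheory.EllipticCurves Literature.NumberTheory.EllipticCurves.ModularForms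
  WeierstrassCurve NumberField IsDedekindDomain
open Summit.BirchSwinnertonDyer.BirchSwinnertonDyer.Theorems
open Summit.BirchSwinnertonDyer.BirchSwinnertonDyer.Rank2Observatory
open Summit.BirchSwinnertonDyer.BirchSwinnertonDyer.Rank1Residual
open Summit.BirchSwinnertonDyer.Rank1Residual.Additive

namespace C707a1

/-- **Kodaira–Néron for `707a1` at every `p ≥ 5`**: `|Δ_min| = 4949`, every exponent `< 5`. [cite: CremonaAlgorithms1997, Table 1 (707a1)]
[cite: SilvermanAEC2009, VII.5.1, VIII.8] -/
theorem kodairaNeron_of_five_le (p : ℕ) (h5 : 5 ≤ p) :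
    haveI := isElliptic_c707a1; haveI := isGloballyMinimal_c707a1;
    ∀ v : HeightOneSpectrum (𝓞 ℚ), ((⟨0, 1, 1, -12, 12⟩ : WeierstrassCurve ℤ).map (Int.castRingHom ℚ)).HasMultiplicativeReductionAt v →
      ¬ p ∣ ((⟨0, 1, 1, -12, 12⟩ : WeierstrassCurve ℤ).map (Int.castRingHom ℚ)).ordMinimalDiscriminant v := by
  haveI := isElliptic_c707a1; haveI := isGloballyMinimal_c707a1
  refine not_dvd_ordMinimalDiscriminant_of_intModel_table intModel (p := p) (Δ₀ := 4949) (by decide +kernel)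
    (B := 8) (lt_of_lt_of_le (by norm_num) (Nat.pow_le_pow_right (by norm_num) h5)) ?_
  intro q hq hqP hqd
  have hn : ((4949 : ℤ).natAbs) = 7 ^ 2 * 101 ^ 1 := by norm_num
  rw [hn] at hqd ⊢
  rcases (Nat.Prime.dvd_mul hqP).mp hqd with h1 | h1
  · obtain rfl := (Nat.prime_dvd_prime_iff_eq hqP (by norm_num)).mp (hqP.dvd_of_dvd_pow h1)
    exact ⟨2, by simp, by decide +kernel, by decide +kernel, Nat.not_dvd_of_pos_of_lt (by norm_num) (by omega)⟩
  · obtain rfl := (Nat.prime_dvd_prime_iff_eq hqP (by norm_num)).mp (hqP.dvd_of_dvd_pow h1)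
    exact ⟨1, by simp, by decide +kernel, by decide +kernel, Nat.not_dvd_of_pos_of_lt (by norm_num) (by omega)⟩

/-- **♠ (1) for `707a1` at every prime `p ≥ 5`** (`|Δ_min| = 4949`, exponents `< 5`) **and semistability** (`gcd(c₄, Δ) = 1`).
[cite: WZhang2014, Hypothesis ♠ (pp. 194–195)] [cite: CremonaAlgorithms1997, Table 1 (707a1)] -/
theorem spadeOne_of_five_le (p : ℕ) [hp : Fact p.Prime] (h5 : 5 ≤ p) :
    haveI := isElliptic_c707a1; haveI := isGloballyMinimal_c707a1;
    (∀ (ℓ : ℕ) [Fact ℓ.Prime], ((⟨0, 1, 1, -12, 12⟩ : WeierstrassCurve ℤ).map (Int.castRingHom ℚ)).HasMultiplicativeReductionAtPrime ℓ →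
      ¬ p ∣ padicValInt ℓ ((⟨0, 1, 1, -12, 12⟩ : WeierstrassCurve ℤ).map (Int.castRingHom ℚ)).minimalDiscriminantInt) ∧
      ((⟨0, 1, 1, -12, 12⟩ : WeierstrassCurve ℤ).map (Int.castRingHom ℚ)).IsSemistable ℤ := by
  haveI := isElliptic_c707a1; haveI := isGloballyMinimal_c707a1
  exact ⟨not_dvd_padicValInt_of_intModel intModel p
      (forall_prime_dvd_of_natAbs_eq_pow_mul_pow (a := 7) (i := 2) (b := 101) (j := 1) (by decide +kernel)
        (by norm_num) (by norm_num) ⟨2, by decide +kernel, by decide +kernel, Nat.not_dvd_of_pos_of_lt (by norm_num) (by omega)⟩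
        ⟨1, by decide +kernel, by decide +kernel, Nat.not_dvd_of_pos_of_lt (by norm_num) (by omega)⟩),
    isSemistable_int_of_intModel_of_isCoprime intModel
      (by rw [Int.isCoprime_iff_gcd_eq_one]; decide +kernel)⟩

/-- **THE CRUX `KolyvaginDepthSupplyKN` AT `707a1` — INTRINSIC ROW, UNIFORM IN THE HEEGNER FIELD AND IN THE PRIME (depth table v16).**
For EVERY admissible `5 ≤ p < 1000` (good ordinary, `ρ_{E,p^n}` onto — hypotheses; Kodaira–Néron and ♠ hold at every `p ≥ 5`), EVERY
imaginary quadratic `K` with `d_K ∉ {−3,−4}`, `p ∤ d_K` and the Heegner hypothesis for `N = 707`, and ANY globally minimal model `T` of the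
twist `E^{(d_K)}` (no arithmetic hypothesis on `T`): IF `ord_{s=1} L(E^{(d_K)}, s) = 1` and `ord_p(L'(T,1)/(Ω_T·Reg_T)) ≤ 1`, THEN the
clause of `KolyvaginDepthSupplyKN` holds at `W = 707a1` VERBATIM (generic `cruxBody_of_twistBSDQuotient_intrinsic_spade` at the curve's kernel
certificates: non-CM, `2 ≤ rank`, `N ≤ 30 000`, Kodaira–Néron / ♠ uniform in `p`). CONDITIONAL on Stein–Wuthrich Thm. 1.1, W. Zhang L8.4 (1) /
9.1, BCS 2025 Cor. 1.3.1, GZK by name; per curve; nothing class-wide; BSD is not proved by it. [cite: SteinWuthrich2013, Thm. 1.1 (p. 1758)]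
[cite: WZhang2014, Lemma 8.4 (1) (p. 236), Thm. 9.1 (p. 240)] [cite: BurungaleCastellaSkinner2025, Cor. 1.3.1 (p. 4)] [cite: CremonaAlgorithms1997, Table 1 (707a1)] -/
theorem cruxBody_intrinsic_at
    (hSW : SteinWuthrich2013_sha_inf_torsionBy_eq_bot_of_two_le_rank)
    (h84 : Literature.NumberTheory.EllipticCurves.WZhang2014_lemma84_exists_minimal_kolyvaginClass_one_selmerCard)
    (hBCS : BurungaleCastellaSkinner2025.cor131_padicValRat_bsd_rank_le_one)
    (hGZK : rank_eq_analyticRank_of_analyticRank_le_one)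
    (p : ℕ) [hp : Fact p.Prime] (h5 : 5 ≤ p) (hp1000 : p < 1000)
    (hgood : haveI := isElliptic_c707a1; haveI := isGloballyMinimal_c707a1; ((⟨0, 1, 1, -12, 12⟩ : WeierstrassCurve ℤ).map (Int.castRingHom ℚ)).HasGoodReductionAtPrime p)
    (hord : haveI := isElliptic_c707a1; haveI := isGloballyMinimal_c707a1; ¬ (p : ℤ) ∣ ((⟨0, 1, 1, -12, 12⟩ : WeierstrassCurve ℤ).map (Int.castRingHom ℚ)).frobeniusTrace p)
    (htower : haveI := isElliptic_c707a1; haveI := isGloballyMinimal_c707a1; ∀ n : ℕ, ((⟨0, 1, 1, -12, 12⟩ : WeierstrassCurve ℤ).map (Int.castRingHom ℚ)).HasSurjectiveModNGaloisRep (p ^ n : ℕ))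
    (K : Type) [Field K] [NumberField K] (hK : IsImaginaryQuadratic K)
    (hD3 : NumberField.discr K ≠ -3) (hD4 : NumberField.discr K ≠ -4) (hpD : ¬ ((p : ℤ) ∣ NumberField.discr K))
    (hH : SatisfiesHeegnerHypothesis 707 K)
    (T : WeierstrassCurve ℚ) [T.IsElliptic] [T.IsGloballyMinimal] (C : WeierstrassCurve.VariableChange ℚ)
    (hC : C • T = ((⟨0, 1, 1, -12, 12⟩ : WeierstrassCurve ℤ).map (Int.castRingHom ℚ)).quadraticTwist (NumberField.discr K : ℚ))
    (hTr : (((⟨0, 1, 1, -12, 12⟩ : WeierstrassCurve ℤ).map (Int.castRingHom ℚ)).quadraticTwist (NumberField.discr K : ℚ)).analyticRank = 1)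
    (hval : ∀ q : ℚ, T.leadingLCoeff / ((T.realPeriodRat * T.regulator : ℝ) : ℂ) = (q : ℂ) → padicValRat p q ≤ 1) :
    haveI := isElliptic_c707a1; haveI := isGloballyMinimal_c707a1;
    ∃ (p : ℕ) (hp : Fact p.Prime), 5 ≤ p ∧ ((⟨0, 1, 1, -12, 12⟩ : WeierstrassCurve ℤ).map (Int.castRingHom ℚ)).HasGoodReductionAtPrime p ∧
      ¬ (p : ℤ) ∣ ((⟨0, 1, 1, -12, 12⟩ : WeierstrassCurve ℤ).map (Int.castRingHom ℚ)).frobeniusTrace p ∧ (∀ n : ℕ, ((⟨0, 1, 1, -12, 12⟩ : WeierstrassCurve ℤ).map (Int.castRingHom ℚ)).HasSurjectiveModNGaloisRep (p ^ n : ℕ)) ∧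
      (∀ v : HeightOneSpectrum (𝓞 ℚ), ((⟨0, 1, 1, -12, 12⟩ : WeierstrassCurve ℤ).map (Int.castRingHom ℚ)).HasMultiplicativeReductionAt v →
        ¬ p ∣ ((⟨0, 1, 1, -12, 12⟩ : WeierstrassCurve ℤ).map (Int.castRingHom ℚ)).ordMinimalDiscriminant v) ∧
      ∃ (K : Type) (_ : Field K) (_ : NumberField K), IsImaginaryQuadratic K ∧
        NumberField.discr K ≠ -3 ∧ NumberField.discr K ≠ -4 ∧
        ∃ (_ : NeZero (((⟨0, 1, 1, -12, 12⟩ : WeierstrassCurve ℤ).map (Int.castRingHom ℚ)).conductorNorm ℤ)), SatisfiesHeegnerHypothesis (((⟨0, 1, 1, -12, 12⟩ : WeierstrassCurve ℤ).map (Int.castRingHom ℚ)).conductorNorm ℤ) K ∧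
        ∃ (Dt : ModularParametrizationData ((⟨0, 1, 1, -12, 12⟩ : WeierstrassCurve ℤ).map (Int.castRingHom ℚ)) (((⟨0, 1, 1, -12, 12⟩ : WeierstrassCurve ℤ).map (Int.castRingHom ℚ)).conductorNorm ℤ)) (β : ℤ) (ι : K →+* ℂ) (n₁ : ℕ)
          (d : KolyvaginHeegnerData Dt β ι n₁), Squarefree n₁ ∧
          (∀ q ∈ n₁.primeFactors, Zhang2014.IsKolyvaginPrime (((⟨0, 1, 1, -12, 12⟩ : WeierstrassCurve ℤ).map (Int.castRingHom ℚ)).conductorNorm ℤ) ((⟨0, 1, 1, -12, 12⟩ : WeierstrassCurve ℤ).map (Int.castRingHom ℚ)) K p q) ∧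
          d.kolyvaginClass hp.out 1 ≠ 0 ∧
          (n₁.primeFactors.card + 1 ≤ ((⟨0, 1, 1, -12, 12⟩ : WeierstrassCurve ℤ).map (Int.castRingHom ℚ)).mordellWeilRank ∨
            (n₁.primeFactors.card ≤ ((⟨0, 1, 1, -12, 12⟩ : WeierstrassCurve ℤ).map (Int.castRingHom ℚ)).mordellWeilRank ∧
              n₁.primeFactors.card + 1 ≤ (((⟨0, 1, 1, -12, 12⟩ : WeierstrassCurve ℤ).map (Int.castRingHom ℚ)).quadraticTwist (NumberField.discr K : ℚ)).mordellWeilRank)) := by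
  haveI := isElliptic_c707a1; haveI := isGloballyMinimal_c707a1
  haveI iNZ : NeZero (((⟨0, 1, 1, -12, 12⟩ : WeierstrassCurve ℤ).map (Int.castRingHom ℚ)).conductorNorm ℤ) := neZero_conductorNorm_of_isElliptic _
  have hsp := spadeOne_of_five_le p h5
  have hHN : SatisfiesHeegnerHypothesis (((⟨0, 1, 1, -12, 12⟩ : WeierstrassCurve ℤ).map (Int.castRingHom ℚ)).conductorNorm ℤ) K := by rw [conductorNorm_eq]; exact hH
  have hS2 : ¬ Squarefree (((⟨0, 1, 1, -12, 12⟩ : WeierstrassCurve ℤ).map (Int.castRingHom ℚ)).conductorNorm ℤ) →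
      (∃ (ℓ : ℕ) (_ : Fact ℓ.Prime), ((⟨0, 1, 1, -12, 12⟩ : WeierstrassCurve ℤ).map (Int.castRingHom ℚ)).HasMultiplicativeReductionAtPrime ℓ ∧
          ¬ p ∣ padicValInt ℓ ((⟨0, 1, 1, -12, 12⟩ : WeierstrassCurve ℤ).map (Int.castRingHom ℚ)).minimalDiscriminantInt) ∧
        ∃ (ℓ₁ ℓ₂ : ℕ) (_ : Fact ℓ₁.Prime) (_ : Fact ℓ₂.Prime), ℓ₁ ≠ ℓ₂ ∧
          ((⟨0, 1, 1, -12, 12⟩ : WeierstrassCurve ℤ).map (Int.castRingHom ℚ)).HasMultiplicativeReductionAtPrime ℓ₁ ∧ ((⟨0, 1, 1, -12, 12⟩ : WeierstrassCurve ℤ).map (Int.castRingHom ℚ)).HasMultiplicativeReductionAtPrime ℓ₂ :=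
    fun hns ↦ absurd (((⟨0, 1, 1, -12, 12⟩ : WeierstrassCurve ℤ).map (Int.castRingHom ℚ)).isSemistable_iff_squarefree_conductorNorm.mp hsp.2) hns
  exact cruxBody_of_twistBSDQuotient_intrinsic_spade hSW h84 hBCS hGZK _ not_hasCM KernelCerts002.C707a1.two_le_rank
    (by rw [conductorNorm_eq]; norm_num) p h5 hp1000 hgood hord htower (kodairaNeron_of_five_le p h5) hsp.1 hS2 K hK hD3 hD4 hpD hHN T C hC hTr 1
    KernelCerts002.C707a1.two_le_rank hval

end C707a1

namespace C997b1

/-- **Kodaira–Néron for `997b1` at every `p ≥ 5`**: `|Δ_min| = 997`, every exponent `< 5`. [cite: CremonaAlgorithms1997, Table 1 (997b1)]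
[cite: SilvermanAEC2009, VII.5.1, VIII.8] -/
theorem kodairaNeron_of_five_le (p : ℕ) (h5 : 5 ≤ p) :
    haveI := isElliptic_c997b1; haveI := isGloballyMinimal_c997b1;
    ∀ v : HeightOneSpectrum (𝓞 ℚ), ((⟨0, -1, 1, -5, -3⟩ : WeierstrassCurve ℤ).map (Int.castRingHom ℚ)).HasMultiplicativeReductionAt v →
      ¬ p ∣ ((⟨0, -1, 1, -5, -3⟩ : WeierstrassCurve ℤ).map (Int.castRingHom ℚ)).ordMinimalDiscriminant v := by
  haveI := isElliptic_c997b1; haveI := isGloballyMinimal_c997b1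
  refine not_dvd_ordMinimalDiscriminant_of_intModel_table intModel (p := p) (Δ₀ := 997) (by decide +kernel)
    (B := 4) (lt_of_lt_of_le (by norm_num) (Nat.pow_le_pow_right (by norm_num) h5)) ?_
  intro q hq hqP hqd
  have hn : ((997 : ℤ).natAbs) = 997 ^ 1 := by norm_num
  rw [hn] at hqd ⊢
  obtain rfl := (Nat.prime_dvd_prime_iff_eq hqP (by norm_num)).mp (hqP.dvd_of_dvd_pow hqd)
  exact ⟨1, by simp, by decide +kernel, by decide +kernel, Nat.not_dvd_of_pos_of_lt (by norm_num) (by omega)⟩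

/-- **♠ (1) for `997b1` at every prime `p ≥ 5`** (`|Δ_min| = 997`, exponents `< 5`) **and semistability** (`gcd(c₄, Δ) = 1`).
[cite: WZhang2014, Hypothesis ♠ (pp. 194–195)] [cite: CremonaAlgorithms1997, Table 1 (997b1)] -/
theorem spadeOne_of_five_le (p : ℕ) [hp : Fact p.Prime] (h5 : 5 ≤ p) :
    haveI := isElliptic_c997b1; haveI := isGloballyMinimal_c997b1;
    (∀ (ℓ : ℕ) [Fact ℓ.Prime], ((⟨0, -1, 1, -5, -3⟩ : WeierstrassCurve ℤ).map (Int.castRingHom ℚ)).HasMultiplicativeReductionAtPrime ℓ →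
      ¬ p ∣ padicValInt ℓ ((⟨0, -1, 1, -5, -3⟩ : WeierstrassCurve ℤ).map (Int.castRingHom ℚ)).minimalDiscriminantInt) ∧
      ((⟨0, -1, 1, -5, -3⟩ : WeierstrassCurve ℤ).map (Int.castRingHom ℚ)).IsSemistable ℤ := by
  haveI := isElliptic_c997b1; haveI := isGloballyMinimal_c997b1
  exact ⟨not_dvd_padicValInt_of_intModel intModel p
      (forall_prime_dvd_of_natAbs_eq_pow (a := 997) (i := 1) (by decide +kernel) (by norm_num)
        ⟨1, by decide +kernel, by decide +kernel, Nat.not_dvd_of_pos_of_lt (by norm_num) (by omega)⟩),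
    isSemistable_int_of_intModel_of_isCoprime intModel
      (by rw [Int.isCoprime_iff_gcd_eq_one]; decide +kernel)⟩

/-- **THE CRUX `KolyvaginDepthSupplyKN` AT `997b1` — INTRINSIC ROW, UNIFORM IN THE HEEGNER FIELD AND IN THE PRIME (depth table v16).**
For EVERY admissible `5 ≤ p < 1000` (good ordinary, `ρ_{E,p^n}` onto — hypotheses; Kodaira–Néron and ♠ hold at every `p ≥ 5`), EVERY
imaginary quadratic `K` with `d_K ∉ {−3,−4}`, `p ∤ d_K` and the Heegner hypothesis for `N = 997`, and ANY globally minimal model `T` of the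
twist `E^{(d_K)}` (no arithmetic hypothesis on `T`): IF `ord_{s=1} L(E^{(d_K)}, s) = 1` and `ord_p(L'(T,1)/(Ω_T·Reg_T)) ≤ 1`, THEN the
clause of `KolyvaginDepthSupplyKN` holds at `W = 997b1` VERBATIM (generic `cruxBody_of_twistBSDQuotient_intrinsic_spade` at the curve's kernel
certificates: non-CM, `2 ≤ rank`, `N ≤ 30 000`, Kodaira–Néron / ♠ uniform in `p`). CONDITIONAL on Stein–Wuthrich Thm. 1.1, W. Zhang L8.4 (1) /
9.1, BCS 2025 Cor. 1.3.1, GZK by name; per curve; nothing class-wide; BSD is not proved by it. [cite: SteinWuthrich2013, Thm. 1.1 (p. 1758)]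
[cite: WZhang2014, Lemma 8.4 (1) (p. 236), Thm. 9.1 (p. 240)] [cite: BurungaleCastellaSkinner2025, Cor. 1.3.1 (p. 4)] [cite: CremonaAlgorithms1997, Table 1 (997b1)] -/
theorem cruxBody_intrinsic_at
    (hSW : SteinWuthrich2013_sha_inf_torsionBy_eq_bot_of_two_le_rank)
    (h84 : Literature.NumberTheory.EllipticCurves.WZhang2014_lemma84_exists_minimal_kolyvaginClass_one_selmerCard)
    (hBCS : BurungaleCastellaSkinner2025.cor131_padicValRat_bsd_rank_le_one)
    (hGZK : rank_eq_analyticRank_of_analyticRank_le_one)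
    (p : ℕ) [hp : Fact p.Prime] (h5 : 5 ≤ p) (hp1000 : p < 1000)
    (hgood : haveI := isElliptic_c997b1; haveI := isGloballyMinimal_c997b1; ((⟨0, -1, 1, -5, -3⟩ : WeierstrassCurve ℤ).map (Int.castRingHom ℚ)).HasGoodReductionAtPrime p)
    (hord : haveI := isElliptic_c997b1; haveI := isGloballyMinimal_c997b1; ¬ (p : ℤ) ∣ ((⟨0, -1, 1, -5, -3⟩ : WeierstrassCurve ℤ).map (Int.castRingHom ℚ)).frobeniusTrace p)
    (htower : haveI := isElliptic_c997b1; haveI := isGloballyMinimal_c997b1; ∀ n : ℕ, ((⟨0, -1, 1, -5, -3⟩ : WeierstrassCurve ℤ).map (Int.castRingHom ℚ)).HasSurjectiveModNGaloisRep (p ^ n : ℕ))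
    (K : Type) [Field K] [NumberField K] (hK : IsImaginaryQuadratic K)
    (hD3 : NumberField.discr K ≠ -3) (hD4 : NumberField.discr K ≠ -4) (hpD : ¬ ((p : ℤ) ∣ NumberField.discr K))
    (hH : SatisfiesHeegnerHypothesis 997 K)
    (T : WeierstrassCurve ℚ) [T.IsElliptic] [T.IsGloballyMinimal] (C : WeierstrassCurve.VariableChange ℚ)
    (hC : C • T = ((⟨0, -1, 1, -5, -3⟩ : WeierstrassCurve ℤ).map (Int.castRingHom ℚ)).quadraticTwist (NumberField.discr K : ℚ))
    (hTr : (((⟨0, -1, 1, -5, -3⟩ : WeierstrassCurve ℤ).map (Int.castRingHom ℚ)).quadraticTwist (NumberField.discr K : ℚ)).analyticRank = 1)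
    (hval : ∀ q : ℚ, T.leadingLCoeff / ((T.realPeriodRat * T.regulator : ℝ) : ℂ) = (q : ℂ) → padicValRat p q ≤ 1) :
    haveI := isElliptic_c997b1; haveI := isGloballyMinimal_c997b1;
    ∃ (p : ℕ) (hp : Fact p.Prime), 5 ≤ p ∧ ((⟨0, -1, 1, -5, -3⟩ : WeierstrassCurve ℤ).map (Int.castRingHom ℚ)).HasGoodReductionAtPrime p ∧
      ¬ (p : ℤ) ∣ ((⟨0, -1, 1, -5, -3⟩ : WeierstrassCurve ℤ).map (Int.castRingHom ℚ)).frobeniusTrace p ∧ (∀ n : ℕ, ((⟨0, -1, 1, -5, -3⟩ : WeierstrassCurve ℤ).map (Int.castRingHom ℚ)).HasSurjectiveModNGaloisRep (p ^ n : ℕ)) ∧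
      (∀ v : HeightOneSpectrum (𝓞 ℚ), ((⟨0, -1, 1, -5, -3⟩ : WeierstrassCurve ℤ).map (Int.castRingHom ℚ)).HasMultiplicativeReductionAt v →
        ¬ p ∣ ((⟨0, -1, 1, -5, -3⟩ : WeierstrassCurve ℤ).map (Int.castRingHom ℚ)).ordMinimalDiscriminant v) ∧
      ∃ (K : Type) (_ : Field K) (_ : NumberField K), IsImaginaryQuadratic K ∧
        NumberField.discr K ≠ -3 ∧ NumberField.discr K ≠ -4 ∧
        ∃ (_ : NeZero (((⟨0, -1, 1, -5, -3⟩ : WeierstrassCurve ℤ).map (Int.castRingHom ℚ)).conductorNorm ℤ)), SatisfiesHeegnerHypothesis (((⟨0, -1, 1, -5, -3⟩ : WeierstrassCurve ℤ).map (Int.castRingHom ℚ)).conductorNorm ℤ) K ∧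
        ∃ (Dt : ModularParametrizationData ((⟨0, -1, 1, -5, -3⟩ : WeierstrassCurve ℤ).map (Int.castRingHom ℚ)) (((⟨0, -1, 1, -5, -3⟩ : WeierstrassCurve ℤ).map (Int.castRingHom ℚ)).conductorNorm ℤ)) (β : ℤ) (ι : K →+* ℂ) (n₁ : ℕ)
          (d : KolyvaginHeegnerData Dt β ι n₁), Squarefree n₁ ∧
          (∀ q ∈ n₁.primeFactors, Zhang2014.IsKolyvaginPrime (((⟨0, -1, 1, -5, -3⟩ : WeierstrassCurve ℤ).map (Int.castRingHom ℚ)).conductorNorm ℤ) ((⟨0, -1, 1, -5, -3⟩ : WeierstrassCurve ℤ).map (Int.castRingHom ℚ)) K p q) ∧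
          d.kolyvaginClass hp.out 1 ≠ 0 ∧
          (n₁.primeFactors.card + 1 ≤ ((⟨0, -1, 1, -5, -3⟩ : WeierstrassCurve ℤ).map (Int.castRingHom ℚ)).mordellWeilRank ∨
            (n₁.primeFactors.card ≤ ((⟨0, -1, 1, -5, -3⟩ : WeierstrassCurve ℤ).map (Int.castRingHom ℚ)).mordellWeilRank ∧
              n₁.primeFactors.card + 1 ≤ (((⟨0, -1, 1, -5, -3⟩ : WeierstrassCurve ℤ).map (Int.castRingHom ℚ)).quadraticTwist (NumberField.discr K : ℚ)).mordellWeilRank)) := by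
  haveI := isElliptic_c997b1; haveI := isGloballyMinimal_c997b1
  haveI iNZ : NeZero (((⟨0, -1, 1, -5, -3⟩ : WeierstrassCurve ℤ).map (Int.castRingHom ℚ)).conductorNorm ℤ) := neZero_conductorNorm_of_isElliptic _
  have hsp := spadeOne_of_five_le p h5
  have hHN : SatisfiesHeegnerHypothesis (((⟨0, -1, 1, -5, -3⟩ : WeierstrassCurve ℤ).map (Int.castRingHom ℚ)).conductorNorm ℤ) K := by rw [conductorNorm_eq]; exact hH
  have hS2 : ¬ Squarefree (((⟨0, -1, 1, -5, -3⟩ : WeierstrassCurve ℤ).map (Int.castRingHom ℚ)).conductorNorm ℤ) →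
      (∃ (ℓ : ℕ) (_ : Fact ℓ.Prime), ((⟨0, -1, 1, -5, -3⟩ : WeierstrassCurve ℤ).map (Int.castRingHom ℚ)).HasMultiplicativeReductionAtPrime ℓ ∧
          ¬ p ∣ padicValInt ℓ ((⟨0, -1, 1, -5, -3⟩ : WeierstrassCurve ℤ).map (Int.castRingHom ℚ)).minimalDiscriminantInt) ∧
        ∃ (ℓ₁ ℓ₂ : ℕ) (_ : Fact ℓ₁.Prime) (_ : Fact ℓ₂.Prime), ℓ₁ ≠ ℓ₂ ∧
          ((⟨0, -1, 1, -5, -3⟩ : WeierstrassCurve ℤ).map (Int.castRingHom ℚ)).HasMultiplicativeReductionAtPrime ℓ₁ ∧ ((⟨0, -1, 1, -5, -3⟩ : WeierstrassCurve ℤ).map (Int.castRingHom ℚ)).HasMultiplicativeReductionAtPrime ℓ₂ :=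
    fun hns ↦ absurd (((⟨0, -1, 1, -5, -3⟩ : WeierstrassCurve ℤ).map (Int.castRingHom ℚ)).isSemistable_iff_squarefree_conductorNorm.mp hsp.2) hns
  exact cruxBody_of_twistBSDQuotient_intrinsic_spade hSW h84 hBCS hGZK _ not_hasCM KernelCertsR01.C997b1.two_le_rank
    (by rw [conductorNorm_eq]; norm_num) p h5 hp1000 hgood hord htower (kodairaNeron_of_five_le p h5) hsp.1 hS2 K hK hD3 hD4 hpD hHN T C hC hTr 1
    KernelCertsR01.C997b1.two_le_rank hval

end C997b1

end Summit.BirchSwinnertonDyer.BirchSwinnertonDyer.Theorems.KolyvaginDepthDoor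

end
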